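import Summits.BirchSwinnertonDyer.BirchSwinnertonDyer.Theorems.ThetaPartnerAtTwoSignedMainConjectureCMTwoRankZeroFlatTwistFamilyLevelSixteen
import Summits.BirchSwinnertonDyer.BirchSwinnertonDyer.Theorems.ThetaPartnerAtTwoSignedMainConjectureCMTwoRankZeroFlatTwistFamilyPrimePower
import Literature.NumberTheory.EllipticCurves.IsogenyHasCMIffJMemProofs
import HarnessLib

/-!
# Route `ThetaPartnerAtTwo`, crux K2r0P `SignedMainConjectureCMTwoRankZeroOfPub` (stmt-BirchSwinnertonDyer-24945),
# line `rankzero` v14/v15, stub (μ♭)_A: DECOMPOSITION of the stub by the thirteen CM `j`-invariants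

Cell `bsd-wall`, width seat `bsd-wall-tp2-p2-w4` (g7). THEOREMS ONLY (no `def`, no named fact, no `sorry`); helper
`--supports` the crux; capstone of the `…FlatTwistFamily*` files (namespace `…Theorems.FlatTwist.Family`).

The registered stub `stub_analyticMuFlatNonUnitCMTwo` (= FLAT, `AnalyticMuFlatCMTwoRankZero`) quantifies over all CM curves
`A/ℚ` of analytic rank `0`, good supersingular at `2` with `a₂ = 0`, off the unit zone. By the class number one theorem
(tree `WeierstrassCurve.hasCM_iff_j_mem_holds`, Silverman *AEC* C.11: `HasCM ↔ j ∈ cmJInvariants`, thirteen values) the stub is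
the conjunction of its thirteen `j`-slices «same binders, plus `A.j = j₀`»:

* `analyticMuFlat_of_slices` — FLAT ⟸ its slices at every `j₀ ∈ cmJInvariants`;
* `analyticMuFlat_of_tail_of_families` — FLAT ⟸ (T) the `j = 0` slice (the TAIL `y² = x³ + k`: infinitely many twist families,
  the class-wide research residue) ∧ (V) the slice over `{1728, −3375, 8000, 54000, 287496, 16581375}` (CM by `ℤ[i]`,
  `ℤ[(1+√−7)/2]`, `ℤ[√−2]`, `ℤ[√−3]`, `ℤ[2i]`, `ℤ[√−7]`: `2` ramified in the CM field, or dividing the conductor of the order, or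
  split — no member is good supersingular at `2` with `a₂ = 0`, so this slice is vacuous; its vacuity is a separate small item
  and is NOT proved here) ∧ (F) the six FAMILY slices `j₀ ∈ {−2¹⁵·3·5³, −2¹⁵, −2¹⁵3³, −2¹⁸3³5³, −2¹⁵3³5³11³, −2¹⁸3³5³23³29³}`,
  each dischargeable from print plus finitely many certificates by `analyticMuFlat_family_of_pub` /
  `…_of_levelSixteen_siblings` / `…_of_unitZone_siblings_primePower` / `analyticMuFlat_of_j_eq_of_siblings` (with `W.j = j₀`).

Nothing about any particular curve is asserted; no slice is proved here; BSD is not proved by any of this.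

References: Silverman *AEC* (2009) App. C §11 [SilvermanAEC2009]; Silverman *ATAEC* (1994) App. A §3 [SilvermanATAEC1994].
-/

set_option autoImplicit false
-- the Theorems namespace of this sub repeats the summit name by design (D-0017 nested layout)
set_option linter.dupNamespace false

noncomputable section

open scoped Classical MatrixGroups ModularForm NumberField NumberTheorySymbols

open NumberField IsDedekindDomain Rat.HeightOneSpectrum CongruenceSubgroup
  Literature.NumberTheory.EllipticCurves Literature.NumberTheory.GaloisRepresentations
  WeierstrassCurve Literature.NumberTheory.EllipticCurves.ModularForms Literature.NumberTheory.EllipticCurves.Rank1Residual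
  Literature.NumberTheory.EllipticCurves.Rank1Residual.Typed
  Summit.BirchSwinnertonDyer.Rank1Residual Summit.BirchSwinnertonDyer.Rank1Residual.Supersingular

namespace Summit.BirchSwinnertonDyer.BirchSwinnertonDyer.Theorems.FlatTwist.Family

/-! ## FLAT is the conjunction of its thirteen `j`-slices -/

/-- **FLAT ⟸ ITS SLICES AT THE THIRTEEN CM `j`-INVARIANTS.** If for every `j₀ ∈ cmJInvariants` the registered stub holds
restricted to `A.j = j₀` (same binders), then it holds as stated: a CM curve over `ℚ` has `j ∈ cmJInvariants`
(`WeierstrassCurve.hasCM_iff_j_mem_holds`, Silverman *AEC* C.11 with Baker–Heegner–Stark). [cite: SilvermanAEC2009, Appendix C §11] -/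
theorem analyticMuFlat_of_slices
    (h : ∀ j₀ ∈ cmJInvariants, ∀ (A : WeierstrassCurve ℚ) [A.IsElliptic] [A.IsGloballyMinimal], A.j = j₀ → A.HasCM → A.analyticRank = 0 →
      GoodSS A 2 → A.frobeniusTrace 2 = 0 → 2 ∣ A.shaOrder * A.tamagawaProduct →
      ∀ [NeZero (A.conductorNorm ℤ)] (f : CuspForm (Gamma0 (A.conductorNorm ℤ)) 2), IsNewformOf A f →
        ∀ (Lplus Lminus : IwasawaAlgebra 2), IsPollackPair f 2 Lplus Lminus →
          ∃ n : ℕ, IsUnit (PowerSeries.coeff n (kobayashiL 1 Lplus Lminus))) :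
    ∀ (A : WeierstrassCurve ℚ) [A.IsElliptic] [A.IsGloballyMinimal], A.HasCM → A.analyticRank = 0 →
      GoodSS A 2 → A.frobeniusTrace 2 = 0 → 2 ∣ A.shaOrder * A.tamagawaProduct →
      ∀ [NeZero (A.conductorNorm ℤ)] (f : CuspForm (Gamma0 (A.conductorNorm ℤ)) 2), IsNewformOf A f →
        ∀ (Lplus Lminus : IwasawaAlgebra 2), IsPollackPair f 2 Lplus Lminus →
          ∃ n : ℕ, IsUnit (PowerSeries.coeff n (kobayashiL 1 Lplus Lminus)) := by
  intro A _ _ hcm hr hss ha h2 _ f hf Lplus Lminus hPP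
  exact h A.j ((WeierstrassCurve.hasCM_iff_j_mem_holds A).mp hcm) A rfl hcm hr hss ha h2 f hf Lplus Lminus hPP

/-- **FLAT ⟸ TAIL ∧ VACUOUS SLICE ∧ SIX FAMILY SLICES.** The thirteen slices grouped: (T) `j = 0`; (V) the six `j`-invariants
with no good-supersingular-at-`2` member (`1728, −3375, 8000, 54000, 287496, 16581375`; vacuity not proved here); (F) the six
family slices `−12288000` (`27a`), `−32768` (`p = 11`), `−884736` (`19`), `−884736000` (`43`), `−147197952000` (`67`),
`−262537412640768000` (`163`), each the conclusion of a family node of the `…FlatTwistFamily*` files. BSD is not proved by this.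
[cite: SilvermanAEC2009, Appendix C §11] [cite: SilvermanATAEC1994, App. A §3] -/
theorem analyticMuFlat_of_tail_of_families
    (hT : ∀ (A : WeierstrassCurve ℚ) [A.IsElliptic] [A.IsGloballyMinimal], A.j = 0 → A.HasCM → A.analyticRank = 0 →
      GoodSS A 2 → A.frobeniusTrace 2 = 0 → 2 ∣ A.shaOrder * A.tamagawaProduct →
      ∀ [NeZero (A.conductorNorm ℤ)] (f : CuspForm (Gamma0 (A.conductorNorm ℤ)) 2), IsNewformOf A f →
        ∀ (Lplus Lminus : IwasawaAlgebra 2), IsPollackPair f 2 Lplus Lminus →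
          ∃ n : ℕ, IsUnit (PowerSeries.coeff n (kobayashiL 1 Lplus Lminus)))
    (hV : ∀ (A : WeierstrassCurve ℚ) [A.IsElliptic] [A.IsGloballyMinimal], A.j ∈ ({1728, -3375, 8000, 54000, 287496, 16581375} : Finset ℚ) → A.HasCM → A.analyticRank = 0 →
      GoodSS A 2 → A.frobeniusTrace 2 = 0 → 2 ∣ A.shaOrder * A.tamagawaProduct →
      ∀ [NeZero (A.conductorNorm ℤ)] (f : CuspForm (Gamma0 (A.conductorNorm ℤ)) 2), IsNewformOf A f →
        ∀ (Lplus Lminus : IwasawaAlgebra 2), IsPollackPair f 2 Lplus Lminus →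
          ∃ n : ℕ, IsUnit (PowerSeries.coeff n (kobayashiL 1 Lplus Lminus)))
    (h27 : ∀ (A : WeierstrassCurve ℚ) [A.IsElliptic] [A.IsGloballyMinimal], A.j = -12288000 → A.HasCM → A.analyticRank = 0 →
      GoodSS A 2 → A.frobeniusTrace 2 = 0 → 2 ∣ A.shaOrder * A.tamagawaProduct →
      ∀ [NeZero (A.conductorNorm ℤ)] (f : CuspForm (Gamma0 (A.conductorNorm ℤ)) 2), IsNewformOf A f →
        ∀ (Lplus Lminus : IwasawaAlgebra 2), IsPollackPair f 2 Lplus Lminus →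
          ∃ n : ℕ, IsUnit (PowerSeries.coeff n (kobayashiL 1 Lplus Lminus)))
    (h11 : ∀ (A : WeierstrassCurve ℚ) [A.IsElliptic] [A.IsGloballyMinimal], A.j = -32768 → A.HasCM → A.analyticRank = 0 →
      GoodSS A 2 → A.frobeniusTrace 2 = 0 → 2 ∣ A.shaOrder * A.tamagawaProduct →
      ∀ [NeZero (A.conductorNorm ℤ)] (f : CuspForm (Gamma0 (A.conductorNorm ℤ)) 2), IsNewformOf A f →
        ∀ (Lplus Lminus : IwasawaAlgebra 2), IsPollackPair f 2 Lplus Lminus →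
          ∃ n : ℕ, IsUnit (PowerSeries.coeff n (kobayashiL 1 Lplus Lminus)))
    (h19 : ∀ (A : WeierstrassCurve ℚ) [A.IsElliptic] [A.IsGloballyMinimal], A.j = -884736 → A.HasCM → A.analyticRank = 0 →
      GoodSS A 2 → A.frobeniusTrace 2 = 0 → 2 ∣ A.shaOrder * A.tamagawaProduct →
      ∀ [NeZero (A.conductorNorm ℤ)] (f : CuspForm (Gamma0 (A.conductorNorm ℤ)) 2), IsNewformOf A f →
        ∀ (Lplus Lminus : IwasawaAlgebra 2), IsPollackPair f 2 Lplus Lminus →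
          ∃ n : ℕ, IsUnit (PowerSeries.coeff n (kobayashiL 1 Lplus Lminus)))
    (h43 : ∀ (A : WeierstrassCurve ℚ) [A.IsElliptic] [A.IsGloballyMinimal], A.j = -884736000 → A.HasCM → A.analyticRank = 0 →
      GoodSS A 2 → A.frobeniusTrace 2 = 0 → 2 ∣ A.shaOrder * A.tamagawaProduct →
      ∀ [NeZero (A.conductorNorm ℤ)] (f : CuspForm (Gamma0 (A.conductorNorm ℤ)) 2), IsNewformOf A f →
        ∀ (Lplus Lminus : IwasawaAlgebra 2), IsPollackPair f 2 Lplus Lminus →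
          ∃ n : ℕ, IsUnit (PowerSeries.coeff n (kobayashiL 1 Lplus Lminus)))
    (h67 : ∀ (A : WeierstrassCurve ℚ) [A.IsElliptic] [A.IsGloballyMinimal], A.j = -147197952000 → A.HasCM → A.analyticRank = 0 →
      GoodSS A 2 → A.frobeniusTrace 2 = 0 → 2 ∣ A.shaOrder * A.tamagawaProduct →
      ∀ [NeZero (A.conductorNorm ℤ)] (f : CuspForm (Gamma0 (A.conductorNorm ℤ)) 2), IsNewformOf A f →
        ∀ (Lplus Lminus : IwasawaAlgebra 2), IsPollackPair f 2 Lplus Lminus →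
          ∃ n : ℕ, IsUnit (PowerSeries.coeff n (kobayashiL 1 Lplus Lminus)))
    (h163 : ∀ (A : WeierstrassCurve ℚ) [A.IsElliptic] [A.IsGloballyMinimal], A.j = -262537412640768000 → A.HasCM → A.analyticRank = 0 →
      GoodSS A 2 → A.frobeniusTrace 2 = 0 → 2 ∣ A.shaOrder * A.tamagawaProduct →
      ∀ [NeZero (A.conductorNorm ℤ)] (f : CuspForm (Gamma0 (A.conductorNorm ℤ)) 2), IsNewformOf A f →
        ∀ (Lplus Lminus : IwasawaAlgebra 2), IsPollackPair f 2 Lplus Lminus →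
          ∃ n : ℕ, IsUnit (PowerSeries.coeff n (kobayashiL 1 Lplus Lminus))) :
    ∀ (A : WeierstrassCurve ℚ) [A.IsElliptic] [A.IsGloballyMinimal], A.HasCM → A.analyticRank = 0 →
      GoodSS A 2 → A.frobeniusTrace 2 = 0 → 2 ∣ A.shaOrder * A.tamagawaProduct →
      ∀ [NeZero (A.conductorNorm ℤ)] (f : CuspForm (Gamma0 (A.conductorNorm ℤ)) 2), IsNewformOf A f →
        ∀ (Lplus Lminus : IwasawaAlgebra 2), IsPollackPair f 2 Lplus Lminus →
          ∃ n : ℕ, IsUnit (PowerSeries.coeff n (kobayashiL 1 Lplus Lminus)) := by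
  refine analyticMuFlat_of_slices fun j₀ hj₀ A _ _ hjA hcm hr hss ha h2 _ f hf Lplus Lminus hPP ↦ ?_
  rw [← hjA] at hj₀
  simp only [cmJInvariants, Finset.mem_insert, Finset.mem_singleton] at hj₀
  rcases hj₀ with h | h | h | h | h | h | h | h | h | h | h | h | h
  · exact hT A h hcm hr hss ha h2 f hf Lplus Lminus hPP
  · exact hV A (by rw [h]; simp) hcm hr hss ha h2 f hf Lplus Lminus hPP
  · exact hV A (by rw [h]; simp) hcm hr hss ha h2 f hf Lplus Lminus hPP
  · exact hV A (by rw [h]; simp) hcm hr hss ha h2 f hf Lplus Lminus hPP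
  · exact h11 A h hcm hr hss ha h2 f hf Lplus Lminus hPP
  · exact hV A (by rw [h]; simp) hcm hr hss ha h2 f hf Lplus Lminus hPP
  · exact hV A (by rw [h]; simp) hcm hr hss ha h2 f hf Lplus Lminus hPP
  · exact h19 A h hcm hr hss ha h2 f hf Lplus Lminus hPP
  · exact h27 A h hcm hr hss ha h2 f hf Lplus Lminus hPP
  · exact hV A (by rw [h]; simp) hcm hr hss ha h2 f hf Lplus Lminus hPP
  · exact h43 A h hcm hr hss ha h2 f hf Lplus Lminus hPP
  · exact h67 A h hcm hr hss ha h2 f hf Lplus Lminus hPP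
  · exact h163 A h hcm hr hss ha h2 f hf Lplus Lminus hPP

end Summit.BirchSwinnertonDyer.BirchSwinnertonDyer.Theorems.FlatTwist.Family

end
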